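import Summits.Langlands.Langlands.Theses.PrimitiveResidueReduction

/-!
# Route PrimitiveResidueReduction — Assembly

The assembly item (stmt-Langlands-27535) of the child route `PrimitiveResidueReduction` (decomp-langlands lens-4 gen 21; a gate-native D-0170
refining child: `--refines route-Langlands-InsolubleResidueReduction:SolubleResidueAutomorphy`, edge split, depth 1) for the crux
SOL = `InsolubleResidueReduction.SolubleResidueAutomorphy` (stmt-Langlands-27767):
`AccessibleResidueAutomorphy → ImprimitiveResidueAutomorphy → PrimitiveResidueAutomorphy → InsolubleResidueReduction.SolubleResidueAutomorphy`.

This is literally the type of the route file's sorry-free deciding theorem `Summit.Langlands.Langlands.Theses.PrimitiveResidueReduction.closes`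
(the primitivity normal form of the soluble residual image: accessible ∣ affinely induced ∣ primitive, by minimal-rank induction).  Nothing here
proves `Langlands` (nor SOL): the assembly records only that the three cell items of the route, taken together, imply the host crux by name.
-/

set_option linter.dupNamespace false -- project-wide option (lakefile weak.linter.dupNamespace); `Summit.Langlands.Langlands` is the mandated namespace

namespace Summit.Langlands.Langlands.Theorems

/-- **Assembly of route PrimitiveResidueReduction** (stmt-Langlands-27535): `ACC → AFF → HEIS → InsolubleResidueReduction.SolubleResidueAutomorphy`.
Proof: unfold `Assembly` and apply the route's deciding theorem `Theses.PrimitiveResidueReduction.closes`. -/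
theorem primitiveResidueReduction_assembly_proof :
    Summit.Langlands.Langlands.Theses.PrimitiveResidueReduction.Assembly := by
  unfold Summit.Langlands.Langlands.Theses.PrimitiveResidueReduction.Assembly
  exact Summit.Langlands.Langlands.Theses.PrimitiveResidueReduction.closes

end Summit.Langlands.Langlands.Theorems
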